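import Literature.IUT.LogVolume.InitialThetaDataVolume
import Literature.IUT.LogVolume.ThetaFieldReading
import HarnessLib

/-!
# `−|log(Θ)|` and [IUTchIII] Cor. 3.12 AT THE Θ-DATA OF A POINT OF THE `λ`-LINE (route D3, part e: the point level)

[IUTchIV] Cor. 2.2 (ii), proof (kurims Apr-2020 manuscript p. 46, read on the page): "it follows formally from (P1),
(P2), (P5), and (P6) that, if one takes the “`F̄`” of [IUTchI], Definition 3.1, to be “`ℚ̄`”, the “`F`” of [IUTchI],
Definition 3.1, to be the number field `F` discussed above [p. 42: `F := F_tpd(√−1, E_{F_tpd}[3·5])`], the “`X_F`”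
of [IUTchI], Definition 3.1, to be the once-punctured elliptic curve associated to `E_F` [the Legendre curve of
`x_E = λ`], the “`l`” … to be the prime number `l` of (P1), and the “`𝕍^bad_mod`” … to be the set `𝕍^bad_mod` of
(P5), then there exist data “`C̲_K`”, “`𝕍̲`”, and “`ε̲`” such that all of the conditions of [IUTchI], Definition 3.1,
(a), (b), (c), (d), (e), (f), are satisfied …; (P7) … In light of (P7), we may apply Theorem 1.10". [IUTchIII]
Cor. 3.12 (kurims p. 174): "Then it holds that `−|log(Θ)| ∈ ℝ`, and `−|log(Θ)| ≥ −|log(q)|`".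

[IUTchIV] Thm. 1.10 (p. 22), the hypotheses under which the log-volume estimate is stated: "Fix a collection of initial
Θ-data as in [IUTchI], Definition 3.1. … Moreover, we assume that the `(3·5)`-torsion points of `E_F` are defined over
`F`, and that `F = F_mod(√−1, E_{F_mod}[2·3·5]) = F_tpd(√−1, E_{F_tpd}[3·5])` — i.e., that `F` is obtained from `F_tpd`
by adjoining `√−1`, together with the fields of definition of the `(3·5)`-torsion points of a model `E_{F_tpd}` of the
elliptic curve `E_F ×_F F̄` over `F_tpd` …".

This file states, at LITERATURE level (importable by the route `IUTThetaPilot`, whose crux `ThetaPartII` lives over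
abc-iut-S-d2's `λ`-line vocabulary `NFPoint` / `Cor22.*`), the closed `Prop`s the cell's planner asked for in the
definition request `defn-NegLogThetaAtDatum`:

* `Cor22.ThetaVolumeDatumAt P l` — a GENUINE Θ-volume datum at the point `P = (F_tpd, λ)` and the prime `l` = the data
  of (P7) under the hypotheses of Thm. 1.10, in the cell's MODEL READING v3 of Cor. 2.2 (ii) (abc-iut-plan
  2026-08-26T02:33:05Z: `E_F :=` the Legendre curve `E_λ` base-changed, `F := F‡(P) = F_tpd(√−1, √λ, √(λ−1), E_λ[3·5])`
  — print's `F_E = F_tpd(√−1, E_λ[15])` plus the twist roots that make it Galois over `F_mod`, the cell's repair of route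
  finding F-L5t7-1), typed over GENERIC carriers (`F, K, F̄` free types with their instances, `E_F : WeierstrassCurve F`
  any curve with `j(E_F) = j(λ)`) and pinned by three print clauses: `j_eq : j(E_F) = j(λ)` in `F` (p. 42 "the elliptic
  curve `E_F`" of `x_E = λ`; the hypothesis of abc-iut-c312-8's `logq_eq_logQAvoid_of_j_extend`), `torsion_thirty_rational`
  (Thm. 1.10 p. 22 "the `(3·5)`-torsion points of `E_F` are defined over `F`", with Def. 3.1 (b)'s `2·3`-torsion), and
  `isSubThetaField : Cor22.IsSubThetaField P F` (Thm. 1.10 p. 22 "`F = F_tpd(√−1, E_{F_tpd}[3·5])`": `F` is generated over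
  `F_tpd` by square roots of `−1, λ, λ−1` and `15`-torsion coordinates of `E_λ`, i.e. `F_tpd ⊆ F ⊆ F‡(P)` intrinsically —
  ONE swappable predicate, `ThetaFieldReading.lean`) — together with the bad-place interface predicates `Pb`, a
  collection of initial Θ-data `D` for `(E_F, l)` ([IUTchI] Def. 3.1, abc-iut-L5-t2's `InitialThetaData`; it carries
  `√−1 ∈ F`, `F/F_mod` Galois, `K = F(E_F[l])`, semistability, `SL₂ ⊆ Im`, the `π₁`-interface …) whose `𝕍^bad_mod`
  is the (P5) choice (`ThetaData.IsP5Choice`, the form of c312-8's point dictionary), and a genuine volume input `I` OF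
  `D` (abc-iut-S2's `ThetaData.IsVolumeInputOf`: `D`'s pilot data and section `V̲`, ideles in the completions `K_{v̲}`).
  WHY A PINNING CLAUSE AT ALL (not a free `F`): the crux's layer-2 child (ii′) is `HullVolumeAtDatum P l (B P l)` with the
  PRINTED uniform constant `B(P,l)` (plan 2026-08-26T01:36:23Z D-ii′); Thm. 1.10 bounds `log(𝔡^F)`, `log(𝔡^K)` (Steps
  (ii)–(iii), pp. 24–26) only for `F` inside this compositum (bounded degree over `F_tpd`, unramified away from `2·3·5`
  and the conductor of `E_λ`), and over a free `F ⊇ F_tpd` the log-different of `K_{v̲}` is unbounded — the clause is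
  what makes (ii′) print's claim rather than a refutable schema; it is a GENERATION clause (no degree constant, no
  concrete type, no isomorphism to transport along), so that print's `F_E`, the cell's `F‡(P)` and anything in between
  inhabit it and the Step (ii) facts become theorems about any such `F` on the (ii′) side;
* `Cor22.Cor312AtDatum P l : Prop` — **[IUTchIII] Cor. 3.12 for every genuine Θ-volume datum at `(P, l)`**
  (`I.Cor312Of`: "`−|log(Θ)| ≥ −|log(q)|`" with both sides the DEFINED numbers of `GenuineLogTheta.lean`); the
  nonarchimedean (Dupuy–Hilado (1.1)) form `Cor312NonarchAtDatum`; CLAIM-form `Prop`s, disputed, never asserted;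
* `Cor22.HullVolumeAtDatum P l δ : Prop` — the computable half ([IUTchIV] Thm. 1.10 Steps (v)–(viii) shape) for
  every genuine datum at `(P, l)`: `I.HullEstimateOf δ`;
* `Cor22.ThetaDataExistsAt P l : Prop` — "there exist data … such that all of the conditions of [IUTchI],
  Definition 3.1 … are satisfied" together with the ideles: inhabitation of `ThetaVolumeDatumAt P l` (the classical
  content of (P7): the model theta field, the `l`-division field, sections of places, `2l`-th roots of the Tate
  parameters in `K_{v̲}` — not proved here; the intended inhabitant is `(F‡(P), E_λ, F‡(P)(E_λ[l]))` with
  abc-iut-L5-t7's `exists_initialThetaData_of_conditions` chain + idele data (`ThetaData.volumeInputOf`,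
  `ThetaVolumeInput.exists_of_ordq`));
* the bookkeeping `gap_le_at`: `Cor312AtDatum ∧ HullVolumeAtDatum δ` give, for every datum,
  `deĝ̲_lgp(P_Θ) − deĝ̲(P_q) ≤ δ + ((l+5)/4)·log π` — where `deĝ̲(P_q) = (1/2l)·log(q^{∤{2,l}}(λ))` by c312-8's
  `logq_eq_logQAvoid_of_j_extend` (summit-side, any model with `j(E_F) = j(λ)`) — the inequality [IUTchIV] Thm. 1.10
  Steps (viii)–(x) turn into `Cor22.Display P l η`.

Design history (every decl NAME of v1 kept throughout): v1 hard-wired the Legendre curve `Cor22.thetaCurve P F` and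
S-d2's `IsThetaField P F` (`F = F_tpd(√−1, E_λ[15])`); that field need not be Galois over `F_mod` (route finding
F-L5t7-1: `λ = −2−√3`, `j = 16000/3`, `F_mod = ℚ`), so [IUTchI] Def. 3.1 (b) fails there, the v1 type was EMPTY at such
points, `ThetaDataExistsAt` refutable and `Cor312AtDatum` vacuously true — a junk edge. v2 (the RE-BASE ruled by abc-iut-plan
2026-08-26T01:02:38Z, p417212) made the carriers generic and pinned `F` by an isomorphism to the `30`-division field
`F_W` of the `F_mod`-model `W = ofJ j(λ)`; that reading was WITHDRAWN as a cell erratum 2026-08-26T02:33Z (F-c312-8-g3-1: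
`W ⊗ F_tpd` is a quadratic twist of `E_λ` ramifying at good primes, which kills the Step (ii) bounds), so v3 replaces
the fields `mem_UP`/`isModelField` (and the constructors `ofModel`/`thetaDataExistsAt_of_model`) by the single
predicate `isSubThetaField`. `F` stays a free number field with `Algebra P.F F` (the `q`-side numbers read `λ` through
it). Because every carrier is a genuine arithmetic object (no free real-valued or glue field), the `∀`-forms are not
junk-refutable: each `T : ThetaVolumeDatumAt P l` computes ITS `−|log(Θ)|`, and by abc-iut-w5-d156's
`ThetaVolumeInput.cor312Of_iff_of_X_eq_of_sigma_eq` that number depends only on `(D's pilot data, D's V̲)`. Deliberately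
NOT here: the construction of `F‡(P)` and of its initial Θ-data (abc-iut-L5-t7 / c312-8 / S2), the existence of ideles,
the summit-side identification `negAbsLogQAtDatum T = −(1/2l)·Cor22.logQAvoid P {2,l}`
(`Summits/ABC/IUTFork/LDHGenuinePoint.lean`), the Step (ii) degree/ramification theorems about fields satisfying
`IsSubThetaField` (campaign S).
[cite: Mochizuki2012, IUTchIV Cor. 2.2 (ii) proof p. 46] [cite: Mochizuki2012, IUTchIV Thm. 1.10 p. 22]
[cite: Mochizuki2012, IUTchIII Cor. 3.12 p. 174] [claim: Mochizuki2012, status: disputed] for every IUT quotation.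
Nothing here asserts `Cor312AtDatum` or `ThetaDataExistsAt` for any point; no side is taken.
-/

noncomputable section

namespace Literature.IUT.LogVolume

namespace Cor22

open Literature.IUT.HodgeTheaters NumberField IsDedekindDomain
open Literature.NumberTheory.DiophantineGeometry.GenEll
open scoped Classical

/-- **A genuine Θ-volume datum at the `λ`-line point `P = (F_tpd, λ)` and the prime `l`** ([IUTchIV] Cor. 2.2 (ii) proof
(P7), p. 46, instantiating [IUTchI] Def. 3.1 under the hypotheses of [IUTchIV] Thm. 1.10, p. 22, in the cell's model
reading v3): generic carriers `F ⊇ F_tpd`, `K`, `F̄`, an elliptic curve `E_F` over `F`, pinned to the data of the proof by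
`j(E_F) = j(λ)` (`j_eq`), "the `(3·5)`-torsion points of `E_F` are defined over `F`" (with the `2·3`-torsion of Def. 3.1
(b): `torsion_thirty_rational`) and "`F = F_tpd(√−1, E_{F_tpd}[3·5])`" in the repaired form `F_tpd ⊆ F ⊆ F_tpd(√−1, √λ,
√(λ−1), E_λ[3·5])` (`isSubThetaField`); then the bad-place interface predicates `Pb`, a collection of initial Θ-data `D`
for `(E_F, l)` with `𝕍^bad_mod` the (P5) choice, and a genuine volume input `I` of `D` (pilot data and `V̲` of `D`;
ideles in the completions `K_{v̲}`). [cite: Mochizuki2012, IUTchIV Cor. 2.2 (ii) proof p. 46]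
[cite: Mochizuki2012, IUTchIV Thm. 1.10 p. 22] -/
structure ThetaVolumeDatumAt (P : NFPoint) (l : ℕ) : Type 1 where
  /-- the field `F ⊇ F_tpd` of the initial Θ-data ("`F = F_mod(√−1, E_{F_mod}[2·3·5])`", as a free carrier) -/
  F : Type
  [instFieldF : Field F]
  [instNumberFieldF : NumberField F]
  [instAlgebraF : Algebra P.F F]
  /-- the field `K` ([IUTchI] Def. 3.1 (c): `K = F(E_F[l])`, pinned inside `F̄` by `D.range_K_iff`) -/
  K : Type
  [instFieldK : Field K]
  [instNumberFieldK : NumberField K]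
  [instAlgebraK : Algebra F K]
  /-- an algebraic closure `F̄` -/
  Fbar : Type
  [instFieldFbar : Field Fbar]
  [instAlgebraFbar : Algebra F Fbar]
  [instAlgebraKFbar : Algebra K Fbar]
  /-- the elliptic curve `E_F` over `F` (the Legendre curve `E_λ ⊗ F` in the model reading, up to `F`-isomorphism) -/
  E : WeierstrassCurve F
  [instIsElliptic : E.IsElliptic]
  /-- `j(E_F) = j(λ)` read in `F` (p. 42 "the elliptic curve `E_F`" of the point `x_E = λ`; the hypothesis `hj` of
  abc-iut-c312-8's `Cor312Prov.logq_eq_logQAvoid_of_j_extend`) -/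
  j_eq : E.j = algebraMap P.F F (jInv P.x)
  /-- Thm. 1.10, p. 22: "the `(3·5)`-torsion points of `E_F` are defined over `F`" (with the `2·3`-torsion of
  Def. 3.1 (b)): every `F̄`-point killed by `30` comes from an `F`-point (the shape of L5-t2's
  `InitialThetaData.torsion_six_rational`; v3: `E_λ[30] ⊆ E_λ(F‡(P))`) -/
  torsion_thirty_rational : ∀ T : GeomPoints Fbar E, (30 : ℤ) • T = 0 →
    T ∈ Set.range (WeierstrassCurve.Affine.Point.baseChange (W' := E.toAffine) F Fbar)
  /-- Thm. 1.10, p. 22: "`F = F_tpd(√−1, E_{F_tpd}[3·5])` — i.e., `F` is obtained from `F_tpd` by adjoining `√−1`, together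
  with the fields of definition of the `(3·5)`-torsion points of a model `E_{F_tpd}` … determined by the Legendre form",
  in the cell's model reading v3 (abc-iut-plan 2026-08-26T02:33:05Z: the twist roots `√λ`, `√(λ−1)` adjoined as well, so
  that the field is Galois over `F_mod`): `F` is generated over `F_tpd` by square roots of `−1`, `λ`, `λ−1` and coordinates
  of `F`-rational `15`-torsion points of `E_λ` — `F_tpd ⊆ F ⊆ F‡(P) = F_tpd(√−1, √λ, √(λ−1), E_λ[3·5])` intrinsically
  (`ThetaFieldReading.lean`; print's `F_E = F_tpd(√−1, E_λ[15])` qualifies too: `IsSubThetaField.of_isThetaField`). This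
  bounds the degree and ramification of `F` (hence of `K = F(E_F[l])`), which every bound on the hull volumes that is
  uniform in the datum ([IUTchIV] Thm. 1.10 Steps (ii)–(iii), pp. 24–26) consumes. -/
  isSubThetaField : IsSubThetaField P F
  /-- the bad-place interface predicates of [IUTchI] Def. 3.1 (e), (f) -/
  Pb : BadPlacePredicates K
  /-- the initial Θ-data for `(E_F, l)` -/
  D : InitialThetaData F K Fbar E l Pb
  /-- the genuine Θ-volume input (pilot data and `V̲` of `D`, ideles) -/
  I : ThetaVolumeInput (fieldOfModuli E) K
  /-- `𝕍^bad_mod` is the (P5) choice: the places of `F` over it are those not dividing `2l` of multiplicative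
  reduction -/
  isP5Choice : ThetaData.IsP5Choice D
  /-- `I` is a volume input OF `D` -/
  isVolumeInputOf : ThetaData.IsVolumeInputOf D I

namespace ThetaVolumeDatumAt

variable {P : NFPoint} {l : ℕ} (T : ThetaVolumeDatumAt P l)

/-- **`−|log(Θ)|` AT THE DATUM** `T`: the defined number of `GenuineLogTheta.lean` for the datum's genuine input
(nonarchimedean hull volumes over the completions `K_{v̲}` plus the archimedean summand).
[cite: Mochizuki2012, IUTchIII Cor. 3.12 p. 173–174] -/
def negLogTheta : ℝ :=
  letI := T.instFieldF; letI := T.instNumberFieldF; letI := T.instFieldK; letI := T.instNumberFieldK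
  letI := T.instAlgebraK
  T.I.negLogTheta

/-- **`−|log(q)|` AT THE DATUM** `T`: `−deĝ̲(P_q) = −(1/2l)·log(q)` of the datum's pilot data over `F_mod`.
[cite: Mochizuki2012, IUTchIV Thm. 1.10 p. 23] -/
def negAbsLogQ : ℝ :=
  letI := T.instFieldF; letI := T.instNumberFieldF; letI := T.instFieldK; letI := T.instNumberFieldK
  letI := T.instAlgebraK
  T.I.negAbsLogQ

/-- [IUTchIII] Cor. 3.12 for the datum `T` (`−|log(q)| ≤ −|log(Θ)|`, the input's `Cor312Of`). CLAIM form, never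
asserted. [claim: Mochizuki2012, status: disputed] -/
def Cor312Of : Prop :=
  letI := T.instFieldF; letI := T.instNumberFieldF; letI := T.instFieldK; letI := T.instNumberFieldK
  letI := T.instAlgebraK
  T.I.Cor312Of

/-- Dupuy–Hilado's (1.1) (nonarchimedean form) for the datum `T`. CLAIM form, never asserted.
[claim: Mochizuki2012, status: disputed] -/
def Cor312NonarchOf : Prop :=
  letI := T.instFieldF; letI := T.instNumberFieldF; letI := T.instFieldK; letI := T.instNumberFieldK
  letI := T.instAlgebraK
  T.I.Cor312NonarchOf

/-- The computable half for the datum `T` with discrepancy `δ` (the input's `HullEstimateOf δ`).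
[cite: Mochizuki2012, IUTchIV Thm. 1.10 Steps (v)–(viii) p. 27–31] -/
def HullEstimateOf (δ : ℝ) : Prop :=
  letI := T.instFieldF; letI := T.instNumberFieldF; letI := T.instFieldK; letI := T.instNumberFieldK
  letI := T.instAlgebraK
  T.I.HullEstimateOf δ

/-- The gap `deĝ̲_lgp(P_Θ) − deĝ̲(P_q)` of the datum's pilot divisors over `F_mod` (`= ((l+1)/24 − 1/(2l))·log(q) > 0`,
c312-3's `PilotDivisors`). [cite: DupuyHilado2025, §3.3] -/
def gap : ℝ :=
  letI := T.instFieldF; letI := T.instNumberFieldF; letI := T.instFieldK; letI := T.instNumberFieldK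
  letI := T.instAlgebraK
  LgpDivisor.ndegLgp T.I.X.thetaPilot - FinDivisor.ndeg _ T.I.X.qPilot

/-- `Cor312Of T` unfolds to `−|log(q)| ≤ −|log(Θ)|` at the datum. [claim: Mochizuki2012, status: disputed] -/
theorem cor312Of_iff : T.Cor312Of ↔ T.negAbsLogQ ≤ T.negLogTheta := Iff.rfl

/-- The nonarchimedean form implies [IUTchIII]'s form for the datum (the archimedean summand is positive).
[cite: Mochizuki2012, IUTchIV Thm. 1.10 Step (vii) p. 30] -/
theorem cor312Of_of_nonarch (h : T.Cor312NonarchOf) : T.Cor312Of :=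
  letI := T.instFieldF; letI := T.instNumberFieldF; letI := T.instFieldK; letI := T.instNumberFieldK
  letI := T.instAlgebraK
  T.I.cor312Of_of_cor312NonarchOf h

/-- For a datum at `(P, l)`, the input's `l` is `l`. [cite: Mochizuki2012, IUTchI Def. 3.1 (c) p. 61] -/
theorem l_eq :
    (letI := T.instFieldF; letI := T.instNumberFieldF; letI := T.instFieldK; letI := T.instNumberFieldK
     letI := T.instAlgebraK
     T.I.l) = l := by
  letI := T.instFieldF; letI := T.instNumberFieldF; letI := T.instFieldK; letI := T.instNumberFieldK
  letI := T.instAlgebraK; letI := T.instAlgebraF; letI := T.instFieldFbar; letI := T.instAlgebraFbar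
  letI := T.instAlgebraKFbar; letI := T.instIsElliptic
  exact T.isVolumeInputOf.l_eq

/-- **The squeeze for the datum**: Cor. 3.12 and the hull estimate with `δ` give
`deĝ̲_lgp(P_Θ) − deĝ̲(P_q) ≤ δ + ((l+5)/4)·log π`. Pure arithmetic; no side taken.
[cite: Mochizuki2012, IUTchIV Thm. 1.10 Steps (viii)–(x) p. 30–32] -/
theorem gap_le {δ : ℝ} (h1 : T.Cor312Of) (h2 : T.HullEstimateOf δ) :
    T.gap ≤ δ + ThetaVolumeInput.archLogTheta l := by
  letI := T.instFieldF; letI := T.instNumberFieldF; letI := T.instFieldK; letI := T.instNumberFieldK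
  letI := T.instAlgebraK
  have h := T.I.gap_le_of_cor312Of_of_hullEstimateOf h1 h2
  rw [T.l_eq] at h
  exact h

end ThetaVolumeDatumAt

/-- **"there exist data … such that all of the conditions of [IUTchI], Definition 3.1, (a)–(f), are satisfied"**
for `(E_P, l)` with the (P5) choice, together with the ideles ([IUTchIV] Cor. 2.2 (ii) proof (P7), p. 46): a genuine
Θ-volume datum at `(P, l)` EXISTS. The classical content (the field `F‡(P) = F_tpd(√−1, √λ, √(λ−1), E_λ[3·5])`, Galois
over `F_mod`, the `l`-division field `K`, sections of places, `2l`-th roots of the Tate parameters in `K_{v̲}` by Tate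
uniformisation) together with the `π₁`-geometric interface objects of Def. 3.1 (d)–(f); a `Prop`, not proved here. [cite: Mochizuki2012, IUTchIV Cor. 2.2 (ii) proof p. 46] -/
def ThetaDataExistsAt (P : NFPoint) (l : ℕ) : Prop := Nonempty (ThetaVolumeDatumAt P l)

/-- **`negLogThetaAtDatum T := −|log(Θ)|` of the genuine datum `T` at `(P, l)`** — the notion asked for by the
cell's definition request `defn-NegLogThetaAtDatum` (alias of `ThetaVolumeDatumAt.negLogTheta`; the number is
DEFINED in `GenuineLogTheta.lean` from the datum's pilot data, completions and ideles, never posited).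
[cite: Mochizuki2012, IUTchIII Cor. 3.12 p. 173–174] -/
abbrev negLogThetaAtDatum {P : NFPoint} {l : ℕ} (T : ThetaVolumeDatumAt P l) : ℝ := T.negLogTheta

/-- **`negAbsLogQAtDatum T := −|log(q)|` of the genuine datum `T` at `(P, l)`** (alias of
`ThetaVolumeDatumAt.negAbsLogQ`; `= −(1/2l)·log(q^{∤{2,l}}(λ))`, summit-side `LDHGenuinePoint`).
[cite: Mochizuki2012, IUTchIV Thm. 1.10 p. 23] -/
abbrev negAbsLogQAtDatum {P : NFPoint} {l : ℕ} (T : ThetaVolumeDatumAt P l) : ℝ := T.negAbsLogQ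

/-- **[IUTchIII] Corollary 3.12 AT THE Θ-DATA OF `(P, l)`**: for every genuine Θ-volume datum at `(P, l)`,
"`−|log(Θ)| ≥ −|log(q)|`" for ITS defined `−|log(Θ)|` ([IUTchIII]'s form with the archimedean summand). CLAIM form;
DISPUTED in print (Scholze–Stix 2018 §2.2); never asserted here — the typed place where the [IUTchIII] Thm. 3.11 ⟹
Cor. 3.12 inference meets the `λ`-line. [claim: Mochizuki2012, status: disputed] -/
@[claim "Mochizuki2012" "disputed"]
def Cor312AtDatum (P : NFPoint) (l : ℕ) : Prop := ∀ T : ThetaVolumeDatumAt P l, T.Cor312Of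

/-- The NONARCHIMEDEAN form (Dupuy–Hilado (1.1): `−deĝ̲(P_q) ≤ ln ν̄_𝕃(hull(U_Θ))`) at the Θ-data of `(P, l)` — the
stronger of the two (`cor312AtDatum_of_nonarch`). CLAIM form; never asserted. [claim: Mochizuki2012, status: disputed] -/
@[claim "Mochizuki2012" "disputed"]
def Cor312NonarchAtDatum (P : NFPoint) (l : ℕ) : Prop := ∀ T : ThetaVolumeDatumAt P l, T.Cor312NonarchOf

/-- **The computable half AT THE Θ-DATA OF `(P, l)`** ([IUTchIV] Thm. 1.10 Steps (v)–(viii) shape): for every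
genuine Θ-volume datum at `(P, l)`, the nonarchimedean part of its `−|log(Θ)|` is at most `−deĝ̲_lgp(P_Θ) + δ`.
A `Prop` to be PROVED for explicit `δ = δ(P, l)` by the log-volume computations of [IUTchIV] §1 (summit-side:
abc-iut-c312-d1's per-summand Step (v) estimate through abc-iut-S2's bridge `LDHGenuine`).
[cite: Mochizuki2012, IUTchIV Thm. 1.10 Steps (v)–(viii) p. 27–31] -/
def HullVolumeAtDatum (P : NFPoint) (l : ℕ) (δ : ℝ) : Prop := ∀ T : ThetaVolumeDatumAt P l, T.HullEstimateOf δ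

/-- `Cor312AtDatum P l` unfolded: `∀ T, negAbsLogQAtDatum T ≤ negLogThetaAtDatum T`.
[claim: Mochizuki2012, status: disputed] -/
theorem cor312AtDatum_iff {P : NFPoint} {l : ℕ} :
    Cor312AtDatum P l ↔ ∀ T : ThetaVolumeDatumAt P l, negAbsLogQAtDatum T ≤ negLogThetaAtDatum T := Iff.rfl

/-- The nonarchimedean form implies [IUTchIII]'s form at `(P, l)`. [cite: Mochizuki2012, IUTchIV Thm. 1.10 Step (vii) p. 30] -/
theorem cor312AtDatum_of_nonarch {P : NFPoint} {l : ℕ} (h : Cor312NonarchAtDatum P l) : Cor312AtDatum P l :=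
  fun T => T.cor312Of_of_nonarch (h T)

/-- **The squeeze at `(P, l)`**: IF Cor. 3.12 holds at the Θ-data of `(P, l)` AND the hull estimate holds with
`δ`, THEN every genuine datum has `deĝ̲_lgp(P_Θ) − deĝ̲(P_q) ≤ δ + ((l+5)/4)·log π` over `F_mod` — the inequality
[IUTchIV] Thm. 1.10 Steps (viii)–(x) convert into the display (`deĝ̲_lgp(P_Θ) = ((l+1)/24)·log(q)`,
`deĝ̲(P_q) = (1/2l)·log(q)`, c312-3's `PilotDivisors`; `log(q) = log(q^{∤{2,l}}(λ))`, c312-8's dictionary). No side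
taken. [cite: Mochizuki2012, IUTchIV Thm. 1.10 Steps (viii)–(x) p. 30–32] -/
theorem gap_le_at {P : NFPoint} {l : ℕ} {δ : ℝ} (h1 : Cor312AtDatum P l) (h2 : HullVolumeAtDatum P l δ)
    (T : ThetaVolumeDatumAt P l) : T.gap ≤ δ + ThetaVolumeInput.archLogTheta l :=
  T.gap_le (h1 T) (h2 T)

/-- Vacuity record: with NO datum at `(P, l)` the claim holds trivially — so a closure by `Cor312AtDatum` is read
together with `ThetaDataExistsAt` (the cell's vacuity discipline). [cite: Mochizuki2012, IUTchIV Cor. 2.2 (ii) proof p. 46] -/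
theorem cor312AtDatum_of_not_exists {P : NFPoint} {l : ℕ} (h : ¬ ThetaDataExistsAt P l) : Cor312AtDatum P l :=
  fun T => absurd ⟨T⟩ h

end Cor22

end Literature.IUT.LogVolume

end
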